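import Summits.AnomalousDissipation.AnomalousDissipation.Theses.KolmogorovPincer
import Summits.AnomalousDissipation.AnomalousDissipation.Theorems.TwohalfdNeg.Negative.LaminarShear
import Summits.AnomalousDissipation.AnomalousDissipation.Theorems.KolmogorovPincerIncrementPincerTG
import Summits.AnomalousDissipation.AnomalousDissipation.Theorems.KolmogorovPincerKnownGradeRungTGTools
import Literature.Analysis.FluidPDE.AlexakisDoeringInterpolation
import Literature.Analysis.FluidPDE.NSHopfEnergy
import Literature.Analysis.FluidPDE.TwoHalfNavierStokes
import Literature.Analysis.FluidPDE.TorusClassicalLerayHopfProofs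
import Literature.Analysis.FunctionSpaces.BesovDifference
import Literature.Analysis.FunctionSpaces.TorusAxisAverage
import Literature.Analysis.FunctionSpaces.TorusPlanarLift
import Literature.Analysis.FunctionSpaces.TorusScalarTrigPoly
import Literature.Analysis.FunctionSpaces.FlatTorus

/-!
# KolmogorovPincer — shear-witness tools (helper module for the asides `TaylorShearWitness` 33119 and
`ParkedShearWitness` 33462 of `Theses/KolmogorovPincer.lean`)

PORT BY NAME of the lens-1 g15 kernel `run/shared/lean/pub/decomp-ad/decomp-ad-lens-1/g15/KolmogorovLagCut_v2.lean`
(§LpInterp `eLpNorm_eight_thirds_le_two_top`, §LinftyRung `eBesovSupSeminorm_half_le_linfty` /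
`eBesovSupSeminorm_half_pow_four_le_linfty`, §ShearWitness.HalfPeriod, and the `p = 3` interpolation with its
Nikol'skii–Besov lift), with the g15 VENDORED copy of the steady-shear Leray–Hopf package REPLACED by the import of
the tree module `Theorems/TwohalfdNeg/Negative/LaminarShear.lean` (`shear n a = (0,0,a cos(2π(n+1)x₀))`,
`profile`, `modeSet`, `isGlobalLerayHopf_shear`, `meanDissipation_shear`, …) and the already-landed
`KolmogorovPincerIncrementPincerTG.eBesovSupSeminorm_one_two_le_sqrt_three`,
`KolmogorovPincerKnownGradeRungTGTools.eLpNorm_sub_translate_le_two_mul`. Nothing new is claimed mathematically: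
same-function `L^p` interpolation, translation identities of a cosine shear at its half period, and the values
of its `L²`/`L^∞`/gradient norms. [decomp-ad lens-1 g61 KP-PORT-3]
-/

set_option linter.dupNamespace false

noncomputable section

namespace Summit.AnomalousDissipation.AnomalousDissipation.Theorems.KolmogorovPincerShearWitnessTools

open scoped BigOperators Topology Classical MeasureTheory InnerProductSpace
open Filter Set Function TopologicalSpace MeasureTheory
open scoped ENNReal NNReal ComplexConjugate
open UnitAddTorus
open Literature.Analysis.FunctionSpaces Literature.Analysis.FunctionSpaces.Torus
open Literature.Analysis.FluidPDE Literature.Analysis.FluidPDE.Torus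
open Summit.AnomalousDissipation.AnomalousDissipation.Theorems.TwohalfdNeg.Negative
open Summit.AnomalousDissipation.AnomalousDissipation.Theorems.KolmogorovPincerIncrementPincerTG
  (eBesovSupSeminorm_one_two_le_sqrt_three)
open Summit.AnomalousDissipation.AnomalousDissipation.Theorems.KolmogorovPincerKnownGradeRungTGTools
  (eLpNorm_sub_translate_le_two_mul)

/-! ## Same-function `L^p` interpolation with `L^∞` -/

section LpInterp

variable {α : Type*} [MeasurableSpace α] {μ : Measure α} {E : Type*} [NormedAddCommGroup E]

/-- **Interpolation with `L^∞`**: `‖g‖_{8/3} ≤ ‖g‖₂^{3/4} ‖g‖_∞^{1/4}`. [folklore] -/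
theorem eLpNorm_eight_thirds_le_two_top {g : α → E} (hg : AEStronglyMeasurable g μ) :
    eLpNorm g (8 / 3 : ℝ≥0∞) μ ≤
      eLpNorm g 2 μ ^ (3 / 4 : ℝ) * eLpNorm g ⊤ μ ^ (1 / 4 : ℝ) := by
  have h83_0 : (8 / 3 : ℝ≥0∞) ≠ 0 := by simp
  have h83_t : (8 / 3 : ℝ≥0∞) ≠ ⊤ := by simp [ENNReal.div_eq_top]
  have t83 : (8 / 3 : ℝ≥0∞).toReal = 8 / 3 := by rw [ENNReal.toReal_div]; norm_num
  rw [eLpNorm_eq_lintegral_rpow_enorm_toReal h83_0 h83_t,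
    eLpNorm_eq_lintegral_rpow_enorm_toReal two_ne_zero ENNReal.ofNat_ne_top, t83, ENNReal.toReal_ofNat,
    eLpNorm_exponent_top]
  set S := eLpNormEssSup g μ with hS
  have hae : ∀ᵐ a ∂μ, ‖g a‖ₑ ^ (8 / 3 : ℝ) ≤ S ^ (2 / 3 : ℝ) * ‖g a‖ₑ ^ (2 : ℝ) := by
    filter_upwards [enorm_ae_le_eLpNormEssSup g μ] with a ha
    calc ‖g a‖ₑ ^ (8 / 3 : ℝ) = ‖g a‖ₑ ^ (2 / 3 : ℝ) * ‖g a‖ₑ ^ (2 : ℝ) := by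
          rw [← ENNReal.rpow_add_of_nonneg _ _ (by norm_num) (by norm_num)]; norm_num
      _ ≤ S ^ (2 / 3 : ℝ) * ‖g a‖ₑ ^ (2 : ℝ) := by gcongr
  have h1 : ∫⁻ a, ‖g a‖ₑ ^ (8 / 3 : ℝ) ∂μ ≤ S ^ (2 / 3 : ℝ) * ∫⁻ a, ‖g a‖ₑ ^ (2 : ℝ) ∂μ := by
    calc ∫⁻ a, ‖g a‖ₑ ^ (8 / 3 : ℝ) ∂μ ≤ ∫⁻ a, S ^ (2 / 3 : ℝ) * ‖g a‖ₑ ^ (2 : ℝ) ∂μ :=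
          lintegral_mono_ae hae
      _ = S ^ (2 / 3 : ℝ) * ∫⁻ a, ‖g a‖ₑ ^ (2 : ℝ) ∂μ := by
          rw [lintegral_const_mul'' _ ((hg.enorm.pow_const _))]
  calc (∫⁻ a, ‖g a‖ₑ ^ (8 / 3 : ℝ) ∂μ) ^ (1 / (8 / 3 : ℝ))
      ≤ (S ^ (2 / 3 : ℝ) * ∫⁻ a, ‖g a‖ₑ ^ (2 : ℝ) ∂μ) ^ (1 / (8 / 3 : ℝ)) :=
        ENNReal.rpow_le_rpow h1 (by norm_num)
    _ = ((∫⁻ a, ‖g a‖ₑ ^ (2 : ℝ) ∂μ) ^ (1 / (2 : ℝ))) ^ (3 / 4 : ℝ) * S ^ (1 / 4 : ℝ) := by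
        rw [ENNReal.mul_rpow_of_nonneg _ _ (by norm_num), ← ENNReal.rpow_mul, ← ENNReal.rpow_mul, mul_comm]
        norm_num


end LpInterp

/-! ## The `(1/2, 8/3)` seminorm under an `L^∞` bound -/

section Linfty

/-- **Ceiling jaw under an `L^∞` bound**:
`[v]_{B^{1/2}_{8/3,∞}} ≤ [v]_{B^1_{2,∞}}^{1/2} · (2‖v‖₂)^{1/4} · (2‖v‖_∞)^{1/4}`. [folklore] -/
theorem eBesovSupSeminorm_half_le_linfty {v : UnitAddTorus (Fin 3) → EuclideanSpace ℝ (Fin 3)}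
    (hv : AEStronglyMeasurable v volume) :
    eBesovSupSeminorm (1 / 2 : ℝ) (8 / 3 : ℝ≥0∞) v volume ≤
      eBesovSupSeminorm 1 2 v volume ^ (1 / 2 : ℝ) * (2 * eLpNorm v 2 volume) ^ (1 / 4 : ℝ) *
        (2 * eLpNorm v ⊤ volume) ^ (1 / 4 : ℝ) := by
  set N₁ := eBesovSupSeminorm 1 2 v volume with hN₁
  rw [eBesovSupSeminorm_def]
  refine iSup₂_le fun h hh => ?_
  have hpos : 0 < ‖h‖ := norm_pos_iff.2 hh
  rw [ENNReal.div_le_iff (ofReal_norm_rpow_pos _ hh).ne' ENNReal.ofReal_ne_top]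
  have hg : AEStronglyMeasurable (fun x => v (x + h) - v x) volume :=
    (aestronglyMeasurable_comp_add_right hv h).sub hv
  have h2 : eLpNorm (fun x => v (x + h) - v x) 2 volume ≤ N₁ * ENNReal.ofReal (‖h‖ ^ (1 : ℝ)) :=
    eLpNorm_sub_le_eBesovSupSeminorm_mul hh
  have h2' : eLpNorm (fun x => v (x + h) - v x) 2 volume ≤ 2 * eLpNorm v 2 volume :=
    eLpNorm_sub_translate_le_two_mul hv h (by norm_num)
  have ht' : eLpNorm (fun x => v (x + h) - v x) ⊤ volume ≤ 2 * eLpNorm v ⊤ volume :=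
    eLpNorm_sub_translate_le_two_mul hv h le_top
  calc eLpNorm (fun x => v (x + h) - v x) (8 / 3 : ℝ≥0∞) volume
      ≤ eLpNorm (fun x => v (x + h) - v x) 2 volume ^ (3 / 4 : ℝ) *
          eLpNorm (fun x => v (x + h) - v x) ⊤ volume ^ (1 / 4 : ℝ) :=
        eLpNorm_eight_thirds_le_two_top hg
    _ = eLpNorm (fun x => v (x + h) - v x) 2 volume ^ (1 / 2 : ℝ) *
          eLpNorm (fun x => v (x + h) - v x) 2 volume ^ (1 / 4 : ℝ) *
          eLpNorm (fun x => v (x + h) - v x) ⊤ volume ^ (1 / 4 : ℝ) := by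
        rw [← ENNReal.rpow_add_of_nonneg _ _ (by norm_num) (by norm_num)]; norm_num
    _ ≤ (N₁ * ENNReal.ofReal (‖h‖ ^ (1 : ℝ))) ^ (1 / 2 : ℝ) * (2 * eLpNorm v 2 volume) ^ (1 / 4 : ℝ) *
          (2 * eLpNorm v ⊤ volume) ^ (1 / 4 : ℝ) := by
        gcongr
    _ = N₁ ^ (1 / 2 : ℝ) * (2 * eLpNorm v 2 volume) ^ (1 / 4 : ℝ) * (2 * eLpNorm v ⊤ volume) ^ (1 / 4 : ℝ) *
          ENNReal.ofReal (‖h‖ ^ (1 / 2 : ℝ)) := by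
        rw [ENNReal.mul_rpow_of_nonneg _ _ (by norm_num),
          ENNReal.ofReal_rpow_of_nonneg (by positivity) (by norm_num), ← Real.rpow_mul hpos.le]
        norm_num
        ring

/-- ENNReal core of the L^∞ rung: `[v]⁴_{B^{1/2}_{8/3,∞}} ≤ (3‖∇v‖²) · (4‖v‖²_∞)`
(probability normalisation of `T³`: `‖v‖₂ ≤ ‖v‖_∞`). -/
theorem eBesovSupSeminorm_half_pow_four_le_linfty {v : UnitAddTorus (Fin 3) → EuclideanSpace ℝ (Fin 3)}
    (hv : MemLp v 2 volume) :
    eBesovSupSeminorm (1 / 2 : ℝ) (8 / 3 : ℝ≥0∞) v volume ^ 4 ≤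
      (3 * Torus.eGradNormSq v) * (4 * eLpNorm v ⊤ volume ^ 2) := by
  set NC := eBesovSupSeminorm (1 / 2 : ℝ) (8 / 3 : ℝ≥0∞) v volume
  set N₁ := eBesovSupSeminorm 1 2 v volume
  set G := Torus.eGradNormSq v
  set S₂ := eLpNorm v 2 volume
  set S := eLpNorm v ⊤ volume
  have hB := eBesovSupSeminorm_half_le_linfty hv.aestronglyMeasurable
  have h1 : N₁ ≤ ENNReal.ofReal (Real.sqrt 3) * G ^ (1 / 2 : ℝ) :=
    eBesovSupSeminorm_one_two_le_sqrt_three hv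
  have h2 : N₁ ^ 2 ≤ 3 * G := by
    calc N₁ ^ 2 ≤ (ENNReal.ofReal (Real.sqrt 3) * G ^ (1 / 2 : ℝ)) ^ 2 := by gcongr
      _ = ENNReal.ofReal (Real.sqrt 3) ^ 2 * (G ^ (1 / 2 : ℝ)) ^ 2 := mul_pow _ _ _
      _ = 3 * G := by
          rw [← ENNReal.ofReal_pow (Real.sqrt_nonneg _), Real.sq_sqrt (by norm_num : (0:ℝ) ≤ 3),
            ← ENNReal.rpow_two (G ^ (1 / 2 : ℝ)), ← ENNReal.rpow_mul, ENNReal.ofReal_ofNat]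
          norm_num
  have h22 : S₂ ≤ S := eLpNorm_le_eLpNorm_of_exponent_le le_top hv.aestronglyMeasurable
  have h3 : NC ^ 4 ≤ N₁ ^ 2 * (2 * S₂) * (2 * S) := by
    calc NC ^ 4 ≤ (N₁ ^ (1 / 2 : ℝ) * (2 * S₂) ^ (1 / 4 : ℝ) * (2 * S) ^ (1 / 4 : ℝ)) ^ 4 := by gcongr
      _ = N₁ ^ 2 * (2 * S₂) * (2 * S) := by
          rw [mul_pow, mul_pow, ← ENNReal.rpow_natCast (N₁ ^ (1 / 2 : ℝ)),
            ← ENNReal.rpow_natCast ((2 * S₂) ^ (1 / 4 : ℝ)), ← ENNReal.rpow_natCast ((2 * S) ^ (1 / 4 : ℝ)),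
            ← ENNReal.rpow_mul, ← ENNReal.rpow_mul, ← ENNReal.rpow_mul, ← ENNReal.rpow_natCast N₁]
          norm_num
  calc NC ^ 4 ≤ N₁ ^ 2 * (2 * S₂) * (2 * S) := h3
    _ ≤ (3 * G) * (2 * S) * (2 * S) := by gcongr
    _ = (3 * G) * (4 * S ^ 2) := by ring

end Linfty

/-! ## The cosine shear `shear n a` of `Theorems/TwohalfdNeg/Negative/LaminarShear`: half-period translation,
scaling, and its norms in `ℝ≥0∞` form -/


section HalfPeriod

/-- The half period `1/(2(n+1))` of the profile along `e₀`, written so that `fourier_half_inv` applies. [new] -/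
noncomputable def halfPeriod (n : ℕ) : ℝ := 1 / 2 / ((((n : ℤ) + 1 : ℤ)) : ℝ)

/-- `halfPeriod n = 1/(2(n+1))`. [new] -/
theorem halfPeriod_eq (n : ℕ) : halfPeriod n = 1 / (2 * ((n : ℝ) + 1)) := by
  unfold halfPeriod
  push_cast
  rw [div_div]

/-- The half period is positive. [new] -/
theorem halfPeriod_pos (n : ℕ) : 0 < halfPeriod n := by
  rw [halfPeriod_eq]; positivity

/-- The half period is at most `1/2`. [new] -/
theorem halfPeriod_le_half (n : ℕ) : halfPeriod n ≤ 1 / 2 := by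
  rw [halfPeriod_eq]
  apply one_div_le_one_div_of_le (by norm_num)
  have : (0 : ℝ) ≤ n := n.cast_nonneg
  linarith

/-- `e_{k₀}(halfPeriod) = -1` for both frequencies of the pair. [new] -/
theorem fourier_apply_zero_halfPeriod {n : ℕ} {k : Fin 2 → ℤ} (hk : k ∈ modeSet n) :
    fourier (k 0) ((halfPeriod n : ℝ) : UnitAddCircle) = -1 := by
  have h0 : fourier (modeFreq n 0) ((halfPeriod n : ℝ) : UnitAddCircle) = -1 := by
    rw [modeFreq_apply_zero]
    exact fourier_half_inv (by omega)
  simp only [modeSet, Finset.mem_insert, Finset.mem_singleton] at hk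
  rcases hk with rfl | rfl
  · exact h0
  · rw [Pi.neg_apply, fourier_neg, h0, map_neg, map_one]

/-- Planar projection of a translation along `e₀`. [new] -/
theorem planarProj_single_zero (c : UnitAddCircle) :
    planarProj (Pi.single (0 : Fin 3) c : UnitAddTorus (Fin 3)) = Pi.single (0 : Fin 2) c := by
  funext j
  rw [planarProj_apply]
  fin_cases j
  · simp
  · simp

/-- The profile flips sign under the half-period translation along `e₀`. [new] -/
theorem profile_add_halfPeriod (n : ℕ) (a : ℝ) (y : UnitAddTorus (Fin 2)) :
    profile n a (y + Pi.single 0 ((halfPeriod n : ℝ) : UnitAddCircle)) = -profile n a y := by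
  rw [profile_apply, profile_apply, ← mul_neg, ← Finset.sum_neg_distrib]
  congr 1
  refine Finset.sum_congr rfl fun k hk => ?_
  rw [mFourier_add_single, fourier_apply_zero_halfPeriod hk]
  simp

/-- The shear flips sign under the half-period translation along `e₀`:
`shear n a (x + e₀/(2(n+1))) = -shear n a x`. [new] -/
theorem shear_add_halfPeriod (n : ℕ) (a : ℝ) (x : UnitAddTorus (Fin 3)) :
    shear n a (x + Pi.single 0 ((halfPeriod n : ℝ) : UnitAddCircle)) = -shear n a x := by
  simp only [shear, twoHalf_eq_comp, Function.comp_apply, planarProj_add, planarProj_single_zero,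
    profile_add_halfPeriod, Pi.zero_apply]
  rw [← map_neg planarEmbed, Prod.neg_mk, neg_zero]

/-- Amplitude scaling of the shear family. [new] -/
theorem shear_const_mul (n : ℕ) (c a : ℝ) : shear n (c * a) = c • shear n a := by
  have h : profile n (c * a) = c • profile n a := by
    funext y
    rw [Pi.smul_apply, smul_eq_mul, profile_mul]
  rw [shear, shear, h, ← twoHalf_smul, smul_zero]

/-- The increment of the shear at the half period is `(-2) •` the shear. [new] -/
theorem shear_sub_translate_halfPeriod (n : ℕ) (a : ℝ) :
    (fun x => shear n a (x + Pi.single 0 ((halfPeriod n : ℝ) : UnitAddCircle)) - shear n a x) =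
      (-2 : ℝ) • shear n a := by
  funext x
  rw [shear_add_halfPeriod, Pi.smul_apply, neg_smul, two_smul]
  abel

/-- `‖δ_{h₀} shear‖_p = 2 ‖shear‖_p` at the half period `h₀ = e₀/(2(n+1))`. [new] -/
theorem eLpNorm_shear_sub_translate_halfPeriod (n : ℕ) (a : ℝ) (p : ℝ≥0∞) :
    eLpNorm (fun x => shear n a (x + Pi.single 0 ((halfPeriod n : ℝ) : UnitAddCircle)) - shear n a x) p volume
      = 2 * eLpNorm (shear n a) p volume := by
  rw [shear_sub_translate_halfPeriod, eLpNorm_const_smul, enorm_neg]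
  congr 1
  rw [Real.enorm_eq_ofReal (by norm_num : (0 : ℝ) ≤ 2), ENNReal.ofReal_ofNat]

/-- Torus points have norm at most `1/2` (sup norm; each coordinate lies in `AddCircle 1`). [folklore] -/
theorem norm_le_half (h : UnitAddTorus (Fin 3)) : ‖h‖ ≤ 1 / 2 :=
  (pi_norm_le_iff_of_nonneg (by norm_num)).2 fun i => by
    simpa using AddCircle.norm_le_half_period (1 : ℝ) (x := h i) one_ne_zero

/-- `‖e₀/(2(n+1))‖ = 1/(2(n+1))`. [new] -/
theorem norm_single_halfPeriod (n : ℕ) :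
    ‖(Pi.single (0 : Fin 3) ((halfPeriod n : ℝ) : UnitAddCircle) : UnitAddTorus (Fin 3))‖ = halfPeriod n := by
  have habs : ‖((halfPeriod n : ℝ) : UnitAddCircle)‖ = |halfPeriod n| :=
    (AddCircle.norm_coe_eq_abs_iff (1 : ℝ) one_ne_zero).2 (by
      rw [abs_one, abs_of_pos (halfPeriod_pos n)]
      exact halfPeriod_le_half n)
  rw [Pi.norm_single, habs, abs_of_pos (halfPeriod_pos n)]

/-- `e₀/(2(n+1)) ≠ 0` in `T³`. [new] -/
theorem single_halfPeriod_ne_zero (n : ℕ) :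
    (Pi.single (0 : Fin 3) ((halfPeriod n : ℝ) : UnitAddCircle) : UnitAddTorus (Fin 3)) ≠ 0 := by
  intro h
  have := norm_single_halfPeriod n
  rw [h, norm_zero] at this
  linarith [halfPeriod_pos n]

/-- `‖shear n a‖_∞ ≤ |a|`. [new] -/
theorem eLpNorm_top_shear_le (n : ℕ) (a : ℝ) : eLpNorm (shear n a) ⊤ volume ≤ ENNReal.ofReal |a| := by
  rw [eLpNorm_exponent_top]
  exact eLpNormEssSup_le_of_ae_bound (Filter.Eventually.of_forall (norm_shear_le n a))

/-- `‖shear n a‖₂² = a²/2` in `ℝ≥0∞`. [new] -/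
theorem eLpNorm_two_shear_sq (n : ℕ) (a : ℝ) :
    eLpNorm (shear n a) 2 volume ^ 2 = ENNReal.ofReal (a ^ 2 / 2) := by
  have h1 : eLpNorm (shear n a) 2 volume = (∫⁻ x, ‖shear n a x‖ₑ ^ 2) ^ (1 / 2 : ℝ) := by
    rw [eLpNorm_eq_lintegral_rpow_enorm_toReal (by norm_num) (by norm_num)]
    simp only [ENNReal.toReal_ofNat, ENNReal.rpow_ofNat]
  rw [h1, ← ENNReal.rpow_natCast _ 2, ← ENNReal.rpow_mul,
    Literature.Analysis.FluidPDE.lintegral_enorm_sq_eq_ofReal ((isSmooth_shear n a).memLp 2), integral_norm_sq_shear]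
  norm_num

end HalfPeriod

/-! ## The `p = 3` interpolation and its Nikol'skii–Besov lift at `(1/3, 3)` -/

section OnsagerCorner

/-- Same-function interpolation `‖g‖₃ ≤ ‖g‖₂^{2/3} ‖g‖_∞^{1/3}` (`|g|³ ≤ ‖g‖_∞ |g|²`). [folklore] -/
theorem eLpNorm_three_le_two_top {α : Type*} [MeasurableSpace α] {μ : Measure α}
    {E' : Type*} [NormedAddCommGroup E'] {g : α → E'} (hg : AEStronglyMeasurable g μ) :
    eLpNorm g 3 μ ≤ eLpNorm g 2 μ ^ (2 / 3 : ℝ) * eLpNorm g ⊤ μ ^ (1 / 3 : ℝ) := by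
  rw [eLpNorm_eq_lintegral_rpow_enorm_toReal (by norm_num : (3 : ℝ≥0∞) ≠ 0) (by norm_num),
    eLpNorm_eq_lintegral_rpow_enorm_toReal two_ne_zero ENNReal.ofNat_ne_top, ENNReal.toReal_ofNat,
    ENNReal.toReal_ofNat, eLpNorm_exponent_top]
  set S := eLpNormEssSup g μ with hS
  have hae : ∀ᵐ a ∂μ, ‖g a‖ₑ ^ (3 : ℝ) ≤ S ^ (1 : ℝ) * ‖g a‖ₑ ^ (2 : ℝ) := by
    filter_upwards [enorm_ae_le_eLpNormEssSup g μ] with a ha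
    calc ‖g a‖ₑ ^ (3 : ℝ) = ‖g a‖ₑ ^ (1 : ℝ) * ‖g a‖ₑ ^ (2 : ℝ) := by
          rw [← ENNReal.rpow_add_of_nonneg _ _ (by norm_num) (by norm_num)]; norm_num
      _ ≤ S ^ (1 : ℝ) * ‖g a‖ₑ ^ (2 : ℝ) := by gcongr
  have h1 : ∫⁻ a, ‖g a‖ₑ ^ (3 : ℝ) ∂μ ≤ S ^ (1 : ℝ) * ∫⁻ a, ‖g a‖ₑ ^ (2 : ℝ) ∂μ := by
    calc ∫⁻ a, ‖g a‖ₑ ^ (3 : ℝ) ∂μ ≤ ∫⁻ a, S ^ (1 : ℝ) * ‖g a‖ₑ ^ (2 : ℝ) ∂μ :=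
          lintegral_mono_ae hae
      _ = S ^ (1 : ℝ) * ∫⁻ a, ‖g a‖ₑ ^ (2 : ℝ) ∂μ := by
          rw [lintegral_const_mul'' _ ((hg.enorm.pow_const _))]
  calc (∫⁻ a, ‖g a‖ₑ ^ (3 : ℝ) ∂μ) ^ (1 / (3 : ℝ))
      ≤ (S ^ (1 : ℝ) * ∫⁻ a, ‖g a‖ₑ ^ (2 : ℝ) ∂μ) ^ (1 / (3 : ℝ)) :=
        ENNReal.rpow_le_rpow h1 (by norm_num)
    _ = ((∫⁻ a, ‖g a‖ₑ ^ (2 : ℝ) ∂μ) ^ (1 / (2 : ℝ))) ^ (2 / 3 : ℝ) * S ^ (1 / 3 : ℝ) := by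
        rw [ENNReal.mul_rpow_of_nonneg _ _ (by norm_num), ← ENNReal.rpow_mul, ← ENNReal.rpow_mul, mul_comm]
        norm_num

/-- **Onsager-corner seminorm under an `L^∞` bound** on `T³`:
`[v]_{B^{1/3}_{3,∞}} ≤ [v]_{B^1_{2,∞}}^{2/3} · (2‖v‖_∞)^{1/3}` (uses `‖h‖ ≤ 1/2 ≤ 1` on the torus). [folklore] -/
theorem eBesovSupSeminorm_third_three_le_linfty {v : UnitAddTorus (Fin 3) → EuclideanSpace ℝ (Fin 3)}
    (hv : AEStronglyMeasurable v volume) :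
    eBesovSupSeminorm (1 / 3 : ℝ) 3 v volume ≤
      eBesovSupSeminorm 1 2 v volume ^ (2 / 3 : ℝ) * (2 * eLpNorm v ⊤ volume) ^ (1 / 3 : ℝ) := by
  set N₁ := eBesovSupSeminorm 1 2 v volume with hN₁
  rw [eBesovSupSeminorm_def]
  refine iSup₂_le fun h hh => ?_
  have hpos : 0 < ‖h‖ := norm_pos_iff.2 hh
  have hle1 : ‖h‖ ≤ 1 := (norm_le_half h).trans (by norm_num)
  rw [ENNReal.div_le_iff (ofReal_norm_rpow_pos _ hh).ne' ENNReal.ofReal_ne_top]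
  have hg : AEStronglyMeasurable (fun x => v (x + h) - v x) volume :=
    (aestronglyMeasurable_comp_add_right hv h).sub hv
  have h2 : eLpNorm (fun x => v (x + h) - v x) 2 volume ≤ N₁ * ENNReal.ofReal (‖h‖ ^ (1 : ℝ)) :=
    eLpNorm_sub_le_eBesovSupSeminorm_mul hh
  have ht' : eLpNorm (fun x => v (x + h) - v x) ⊤ volume ≤ 2 * eLpNorm v ⊤ volume :=
    eLpNorm_sub_translate_le_two_mul hv h le_top
  calc eLpNorm (fun x => v (x + h) - v x) 3 volume
      ≤ eLpNorm (fun x => v (x + h) - v x) 2 volume ^ (2 / 3 : ℝ) *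
          eLpNorm (fun x => v (x + h) - v x) ⊤ volume ^ (1 / 3 : ℝ) :=
        eLpNorm_three_le_two_top hg
    _ ≤ (N₁ * ENNReal.ofReal (‖h‖ ^ (1 : ℝ))) ^ (2 / 3 : ℝ) * (2 * eLpNorm v ⊤ volume) ^ (1 / 3 : ℝ) := by
        gcongr
    _ = N₁ ^ (2 / 3 : ℝ) * (2 * eLpNorm v ⊤ volume) ^ (1 / 3 : ℝ) * ENNReal.ofReal (‖h‖ ^ (2 / 3 : ℝ)) := by
        rw [ENNReal.mul_rpow_of_nonneg _ _ (by norm_num),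
          ENNReal.ofReal_rpow_of_nonneg (by positivity) (by norm_num), ← Real.rpow_mul hpos.le]
        norm_num
        ring
    _ ≤ N₁ ^ (2 / 3 : ℝ) * (2 * eLpNorm v ⊤ volume) ^ (1 / 3 : ℝ) * ENNReal.ofReal (‖h‖ ^ (1 / 3 : ℝ)) := by
        gcongr N₁ ^ (2 / 3 : ℝ) * (2 * eLpNorm v ⊤ volume) ^ (1 / 3 : ℝ) * ENNReal.ofReal ?_
        exact Real.rpow_le_rpow_of_exponent_ge hpos hle1 (by norm_num)


end OnsagerCorner

end Summit.AnomalousDissipation.AnomalousDissipation.Theorems.KolmogorovPincerShearWitnessTools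

end
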